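import Literature.Computability.AlgebraicComplexity.DDS21BloatedRatioDeborder
import HarnessLib

/-!
# Dutta–Dwivedi–Saxena 2021, Thm. 3.2 at `k = 2`: the balanced `ε`-normal form (proofs)

Topic `Literature/Computability/AlgebraicComplexity`; a PROOFS file (D-0014): theorems only, no
definitions, no named facts (cell `val-lit`, row X2-DDS21; the `k = 2` case of the
`DDS2021_thm_3_2` programme, `ε`-side, part A). Sources: P. Dutta, P. Dwivedi, N. Saxena,
*Demystifying the border of depth-3 algebraic circuits*, FOCS 2021 [DuttaDwivediSaxena2022] (held
full version `paper:galaxy-pdf-7641649743695546420`, §3 proof of Thm. 3.2, p0026–p0028), and the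
detailed `k = 2` proof printed in the survey P. Dutta, V. Lysikov, *Recent Advances in Debordering
Methods* (2025) [DuttaLysikov2025] (held `paper:arxiv-2510.13049`, §4.4.1, proof sketch of Thm. 59,
chunk p0023).

## What is proved

[DuttaLysikov2025, §4.4.1] (p0023 L19–24): "`g := T₁ + T₂ = f + ε·S`, where … each of them is a
product of linear polynomials … Suppose `val_ε(T_i) = −a_i`, i.e. `T_i = ε^{−a_i}·ℓ_{i,1}⋯ℓ_{i,s}`,
… each `ℓ_{i,j,0} := ℓ_{i,j}|_{ε=0}` is nonzero. One can assume that `a₁ = a₂ > 0`: If one of them is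
`≤ 0`, then for the limit to exist, each `a_i` has to be nonpositive, implying `f ∈ ΣΠΣ(2) ⊆ VBP`.
And, if `a₁, a₂ > 0`, but `a₁ ≠ a₂`, then clearly `val_ε(T₁ + T₂) = min(−a₁, −a₂) < 0`, a
contradiction."

`border_spsClass_two_normalForm` renders this dichotomy for the tree's classes: if
`f ∈ \overline{Σ^{[2]}Π^{[d]}Σ}` (`f ∈ border (spsClass (RatFunc F) n 2 d)`), then EITHER
`f ∈ Σ^{[2]}Π^{[d]}Σ` over `F` exactly (`f ∈ spsClass F n 2 d`), OR the BALANCED NORMAL FORM holds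
over `F[ε]`:

  `C s₀ · ∏_j ℓ(β₀ⱼ) + C s₁ · ∏_j ℓ(β₁ⱼ) = ε^a · H`, `a ≥ 1`, `s_i(0) ≠ 0`, every factor `ℓ(β_ij)`
  with a coefficient that is a unit at `ε = 0` (so `ℓ(β_ij)|_{ε=0} ≠ 0`), and `H|_{ε=0} = κ · f`,
  `κ ∈ F^×`

(the two integral products then cancel at `ε = 0`: `s₀(0)·t₀ = −s₁(0)·t₁`). The valuation
bookkeeping is `two_term_limit` (three `ε`-adic orders compared at `ε = 0`). Part B
(`DDS21TopFaninTwoDiDIL.lean`) derives from this normal form the divide-and-derive identity at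
`ε = 0`.

Honest framing: the `k = 2` case of a 2021 de-bordering theorem, `ε`-side only; `DDS2021_thm_3_2`
(all `k`) remains a named fact; nothing here bears on VP versus VNP, which is NOT proved.

## References

* [DuttaDwivediSaxena2022] P. Dutta, P. Dwivedi, N. Saxena, *Demystifying the border of depth-3
  algebraic circuits*, FOCS 2021; full version `paper:galaxy-pdf-7641649743695546420`, §3 Thm. 3.2
  and its proof (p0026 L713–718), Claim 3.3 proof (p0027 L729–735: "Extracting the maximum
  `ε`-power … it must happen that `… ≥ 0`").
* [DuttaLysikov2025] P. Dutta, V. Lysikov, *Recent Advances in Debordering Methods*, arXiv:2510.13049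
  (2025), §4.4.1 "Debordering `\overline{ΣΠΣ(2)}`", proof sketch of Thm. 59 (`paper:arxiv-2510.13049`
  p0023 L17–24).
-/

noncomputable section

open MvPolynomial
open scoped BigOperators Polynomial

namespace Literature.Computability.AlgebraicComplexity

namespace DDS2021

section TopFaninTwo

variable {F : Type*} [Field F] {n : ℕ}

/-! ### Affine forms: coefficient bookkeeping -/

/-- The constant coefficient of an affine form. [folklore] -/
private theorem coeff_zero_affine {R : Type*} [CommSemiring R] (β : Option (Fin n) → R) :
    coeff 0 (C (β none) + ∑ m, C (β (some m)) * X m : MvPolynomial (Fin n) R) = β none := by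
  classical
  rw [coeff_add, coeff_C, if_pos rfl, coeff_sum, Finset.sum_eq_zero, add_zero]
  intro m _
  rw [coeff_C_mul, coeff_X, if_neg (Finsupp.single_ne_zero.mpr one_ne_zero), mul_zero]

/-- The coefficient of `x_m` of an affine form. [folklore] -/
private theorem coeff_single_affine {R : Type*} [CommSemiring R] (β : Option (Fin n) → R)
    (m : Fin n) :
    coeff (Finsupp.single m 1) (C (β none) + ∑ m, C (β (some m)) * X m : MvPolynomial (Fin n) R) =
      β (some m) := by
  classical
  rw [coeff_add, coeff_C, if_neg (Finsupp.single_ne_zero.mpr one_ne_zero).symm, zero_add,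
    coeff_sum, Finset.sum_eq_single m]
  · rw [coeff_C_mul, coeff_X, if_pos rfl, mul_one]
  · intro m' _ hm'
    rw [coeff_C_mul, coeff_X, if_neg, mul_zero]
    intro h
    exact hm' (Finsupp.single_left_injective one_ne_zero h)
  · intro h; exact absurd (Finset.mem_univ m) h

/-- An affine form with a nonzero coefficient is nonzero. [folklore] -/
private theorem affine_ne_zero {R : Type*} [CommSemiring R] {β : Option (Fin n) → R}
    (h : ∃ o, β o ≠ 0) :
    (C (β none) + ∑ m, C (β (some m)) * X m : MvPolynomial (Fin n) R) ≠ 0 := by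
  obtain ⟨o, ho⟩ := h
  intro h0
  cases o with
  | none => exact ho (by rw [← coeff_zero_affine β, h0, coeff_zero])
  | some m => exact ho (by rw [← coeff_single_affine β m, h0, coeff_zero])

/-- Ring homomorphisms act coefficientwise on affine forms. [folklore] -/
private theorem map_affine {R S : Type*} [CommSemiring R] [CommSemiring S] (φ : R →+* S)
    (β : Option (Fin n) → R) :
    map φ (C (β none) + ∑ m, C (β (some m)) * X m : MvPolynomial (Fin n) R) =
      C (φ (β none)) + ∑ m, C (φ (β (some m))) * X m := by
  simp only [map_add, map_sum, map_mul, map_C, map_X]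

/-- Scaling an affine form scales its coefficients. [folklore] -/
private theorem C_mul_affine {R : Type*} [CommSemiring R] (c : R) (β : Option (Fin n) → R) :
    C c * (C (β none) + ∑ m, C (β (some m)) * X m : MvPolynomial (Fin n) R) =
      C (c * β none) + ∑ m, C (c * β (some m)) * X m := by
  rw [mul_add, ← C_mul, Finset.mul_sum]
  refine congrArg _ (Finset.sum_congr rfl fun m _ => ?_)
  rw [← mul_assoc, ← C_mul]

/-! ### Comparing three `ε`-adic orders at `ε = 0` -/

/-- Cancelling a power of `ε` in `F[ε][x]` (a domain). [folklore] -/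
private theorem cancel_X_pow {σ : Type*} (k : ℕ) {A B : MvPolynomial σ F[X]}
    (h : C (Polynomial.X ^ k) * A = C (Polynomial.X ^ k) * B) : A = B :=
  mul_left_cancel₀ (C_ne_zero.mpr (pow_ne_zero _ Polynomial.X_ne_zero)) h

/-- The reduction at `ε = 0` of `ε^k · R` for `k ≥ 1` vanishes. [folklore] -/
private theorem constantCoeff_X_pow_mul {k : ℕ} (hk : 0 < k) (R : F[X]) :
    Polynomial.constantCoeff (Polynomial.X ^ k * R) = 0 := by
  rw [Polynomial.constantCoeff_apply, Polynomial.coeff_X_pow_mul', if_neg (Nat.not_le.mpr hk)]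

/-- **Two terms against one: the `ε`-adic order comparison** behind "one can assume
`a₁ = a₂ > 0`". If `ε^{e₀} R₀ · A₀ + ε^{e₁} R₁ · A₁ = ε^{e₂} R₂ · A₂` over `F[ε][x]` with
`Rᵢ(0) ≠ 0` and `A₀(0), A₁(0) ≠ 0`, then either `e₂ ≤ e₀`, `e₂ ≤ e₁` and at `ε = 0`
`[e₀ = e₂] R₀(0)·A₀(0) + [e₁ = e₂] R₁(0)·A₁(0) = R₂(0)·A₂(0)` ("each `a_i` has to be nonpositive,
implying `f ∈ ΣΠΣ(2)`"), or `e₀ = e₁ < e₂` and `R₀ · A₀ + R₁ · A₁ = ε^{e₂ − e₀} R₂ · A₂`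
("`a₁ = a₂ > 0`"; the case `a₁ ≠ a₂` both positive is contradictory).
[cite: DuttaLysikov2025, §4.4.1 proof sketch of Thm. 59 (arXiv:2510.13049, p0023 L21–24)] -/
theorem two_term_limit {σ : Type*} {e₀ e₁ e₂ : ℕ} {R₀ R₁ R₂ : F[X]}
    (hR₀ : R₀.coeff 0 ≠ 0) (hR₁ : R₁.coeff 0 ≠ 0)
    {A₀ A₁ A₂ : MvPolynomial σ F[X]}
    (hA₀ : map (Polynomial.constantCoeff : F[X] →+* F) A₀ ≠ 0)
    (hA₁ : map (Polynomial.constantCoeff : F[X] →+* F) A₁ ≠ 0)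
    (h : C (Polynomial.X ^ e₀ * R₀) * A₀ + C (Polynomial.X ^ e₁ * R₁) * A₁ =
      C (Polynomial.X ^ e₂ * R₂) * A₂) :
    (e₂ ≤ e₀ ∧ e₂ ≤ e₁ ∧
      C (if e₀ = e₂ then R₀.coeff 0 else 0) * map (Polynomial.constantCoeff : F[X] →+* F) A₀ +
        C (if e₁ = e₂ then R₁.coeff 0 else 0) * map (Polynomial.constantCoeff : F[X] →+* F) A₁ =
      C (R₂.coeff 0) * map (Polynomial.constantCoeff : F[X] →+* F) A₂) ∨
    (e₀ = e₁ ∧ e₀ < e₂ ∧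
      C R₀ * A₀ + C R₁ * A₁ = C (Polynomial.X ^ (e₂ - e₀) * R₂) * A₂) := by
  -- reduce at `ε = 0` after cancelling `ε^k`, `k ≤ min e₀ e₁ e₂`
  have key : ∀ k : ℕ, k ≤ e₀ → k ≤ e₁ → k ≤ e₂ →
      C (Polynomial.X ^ (e₀ - k) * R₀) * A₀ + C (Polynomial.X ^ (e₁ - k) * R₁) * A₁ =
        C (Polynomial.X ^ (e₂ - k) * R₂) * A₂ := by
    intro k h0 h1 h2
    apply cancel_X_pow (F := F) k
    have e0 : (Polynomial.X : F[X]) ^ e₀ = Polynomial.X ^ k * Polynomial.X ^ (e₀ - k) := by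
      rw [← pow_add, Nat.add_sub_cancel' h0]
    have e1 : (Polynomial.X : F[X]) ^ e₁ = Polynomial.X ^ k * Polynomial.X ^ (e₁ - k) := by
      rw [← pow_add, Nat.add_sub_cancel' h1]
    have e2 : (Polynomial.X : F[X]) ^ e₂ = Polynomial.X ^ k * Polynomial.X ^ (e₂ - k) := by
      rw [← pow_add, Nat.add_sub_cancel' h2]
    rw [e0, e1, e2] at h
    simp only [map_mul] at h ⊢
    linear_combination h
  have red : ∀ k : ℕ, k ≤ e₀ → k ≤ e₁ → k ≤ e₂ →
      C (Polynomial.constantCoeff (Polynomial.X ^ (e₀ - k) * R₀)) *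
            map (Polynomial.constantCoeff : F[X] →+* F) A₀ +
          C (Polynomial.constantCoeff (Polynomial.X ^ (e₁ - k) * R₁)) *
            map (Polynomial.constantCoeff : F[X] →+* F) A₁ =
        C (Polynomial.constantCoeff (Polynomial.X ^ (e₂ - k) * R₂)) *
          map (Polynomial.constantCoeff : F[X] →+* F) A₂ := by
    intro k h0 h1 h2
    have h' := congrArg (map (Polynomial.constantCoeff : F[X] →+* F)) (key k h0 h1 h2)
    rw [map_add, map_mul (map (Polynomial.constantCoeff : F[X] →+* F)) (C _) A₀,
      map_mul (map (Polynomial.constantCoeff : F[X] →+* F)) (C _) A₁,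
      map_mul (map (Polynomial.constantCoeff : F[X] →+* F)) (C _) A₂, map_C, map_C, map_C] at h'
    exact h'
  by_cases hle : e₂ ≤ e₀ ∧ e₂ ≤ e₁
  · -- `e₂` is the minimum: reduce after cancelling `ε^{e₂}`
    left
    refine ⟨hle.1, hle.2, ?_⟩
    have h' := red e₂ hle.1 hle.2 le_rfl
    have h0 : Polynomial.constantCoeff (Polynomial.X ^ (e₀ - e₂) * R₀) =
        if e₀ = e₂ then R₀.coeff 0 else 0 := by
      split_ifs with h00
      · rw [h00, Nat.sub_self, pow_zero, one_mul, Polynomial.constantCoeff_apply]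
      · exact constantCoeff_X_pow_mul (by omega) R₀
    have h1 : Polynomial.constantCoeff (Polynomial.X ^ (e₁ - e₂) * R₁) =
        if e₁ = e₂ then R₁.coeff 0 else 0 := by
      split_ifs with h11
      · rw [h11, Nat.sub_self, pow_zero, one_mul, Polynomial.constantCoeff_apply]
      · exact constantCoeff_X_pow_mul (by omega) R₁
    rw [h0, h1, Nat.sub_self, pow_zero, one_mul, Polynomial.constantCoeff_apply] at h'
    exact h'
  · right
    rw [not_and_or, not_le, not_le] at hle
    -- the smaller of `e₀, e₁` is `< e₂`; the two must then be equal
    have hmin : min e₀ e₁ < e₂ := by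
      rcases hle with h0 | h1
      · exact lt_of_le_of_lt (min_le_left _ _) h0
      · exact lt_of_le_of_lt (min_le_right _ _) h1
    have h01 : e₀ = e₁ := by
      by_contra hne
      rcases lt_or_gt_of_ne hne with hlt | hgt
      · have he2 : e₀ < e₂ := (le_min le_rfl hlt.le).trans_lt hmin
        have h' := red e₀ le_rfl hlt.le he2.le
        rw [Nat.sub_self, pow_zero, one_mul, constantCoeff_X_pow_mul (by omega) R₁,
          constantCoeff_X_pow_mul (by omega) R₂, C_0, zero_mul, zero_mul, add_zero,
          Polynomial.constantCoeff_apply] at h'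
        exact hA₀ ((mul_eq_zero.mp h').resolve_left (C_ne_zero.mpr hR₀))
      · have he2 : e₁ < e₂ := (le_min hgt.le le_rfl).trans_lt hmin
        have h' := red e₁ hgt.le le_rfl he2.le
        rw [Nat.sub_self, pow_zero, one_mul, constantCoeff_X_pow_mul (by omega) R₀,
          constantCoeff_X_pow_mul (by omega) R₂, C_0, zero_mul, zero_mul, zero_add,
          Polynomial.constantCoeff_apply] at h'
        exact hA₁ ((mul_eq_zero.mp h').resolve_left (C_ne_zero.mpr hR₁))
    subst h01
    rw [min_self] at hmin
    refine ⟨rfl, hmin, ?_⟩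
    have h' := key e₀ le_rfl le_rfl hmin.le
    rw [Nat.sub_self, pow_zero, one_mul, one_mul] at h'
    exact h'

/-! ### The `k = 2` dichotomy -/

/-- Padding: a single product of `d + 1` affine forms is a sum of two (the second one zero).
[folklore] -/
private theorem isSPS_two_of_one {d : ℕ} {f : MvPolynomial (Fin n) F}
    (hf : MS2021.IsSPS 1 (d + 1) f) : MS2021.IsSPS 2 (d + 1) f := by
  obtain ⟨α, rfl⟩ := hf
  refine ⟨![α 0, fun _ _ => 0], ?_⟩
  rw [Fin.sum_univ_one, Fin.sum_univ_two]
  have h0 : (∏ j : Fin (d + 1), (C (0 : F) + ∑ m : Fin n, C (0 : F) * X m) :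
      MvPolynomial (Fin n) F) = 0 :=
    Finset.prod_eq_zero (Finset.mem_univ (0 : Fin (d + 1))) (by simp)
  simp only [Matrix.cons_val_zero, Matrix.cons_val_one]
  rw [h0, add_zero]

/-- **The balanced `ε`-normal form of a border `Σ^{[2]}Π^{[d]}Σ` circuit, PROVED** (the opening
of the `k = 2` de-bordering proof, "one can assume `a₁ = a₂ > 0`"): a polynomial in the border of
`Σ^{[2]}Π^{[d]}Σ` is either EXACTLY a sum of two products of `d` affine forms over `F`, or its
approximant normalises over `F[ε]` to `C s₀·∏_j ℓ(β₀ⱼ) + C s₁·∏_j ℓ(β₁ⱼ) = ε^a·H` with `a ≥ 1`,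
`s_i(0) ≠ 0`, every `ℓ(β_ij)` having a coefficient with nonzero constant term (so
`ℓ(β_ij)|_{ε=0} ≠ 0`), and `H|_{ε=0} = κ·f`, `κ ≠ 0`.
[cite: DuttaLysikov2025, §4.4.1 proof sketch of Thm. 59 (arXiv:2510.13049, p0023 L17–24); DuttaDwivediSaxena2022, §3 proof of Thm. 3.2 (full version p0026 L713–718, p0027 L729–735)] -/
theorem border_spsClass_two_normalForm {d : ℕ} {f : MvPolynomial (Fin n) F}
    (hf : f ∈ border (spsClass (RatFunc F) n 2 d)) :
    f ∈ spsClass F n 2 d ∨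
    ∃ (a : ℕ) (s : Fin 2 → F[X]) (β : Fin 2 → Fin d → Option (Fin n) → F[X])
      (H : MvPolynomial (Fin n) F[X]) (κ : F),
      0 < a ∧ (∀ i, (s i).coeff 0 ≠ 0) ∧ κ ≠ 0 ∧ (∀ i j, ∃ o, (β i j o).coeff 0 ≠ 0) ∧
      map (Polynomial.constantCoeff : F[X] →+* F) H = C κ * f ∧
      ∑ i, C (s i) * ∏ j, (C (β i j none) + ∑ m, C (β i j (some m)) * X m) =
        C (Polynomial.X ^ a) * H := by
  classical
  have hinj := RatFunc.algebraMap_injective F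
  obtain ⟨g, hg𝒞, hfg⟩ := hf
  obtain ⟨α, hgα⟩ : MS2021.IsSPS 2 d g := hg𝒞
  obtain ⟨G, hGg, hGf⟩ := isEpsApprox_iff_exists_map.mp hfg
  -- `d = 0`: `g = 2 = f`
  rcases Nat.eq_zero_or_pos d with hd | hd
  · subst hd
    left
    have hg2 : g = C 2 := by
      rw [hgα, Fin.sum_univ_two]
      simp only [Finset.univ_eq_empty, Finset.prod_empty]
      rw [map_ofNat]
      norm_num
    have hG2 : G = C 2 := by
      apply map_injective (algebraMap F[X] (RatFunc F)) hinj
      rw [hGg, hg2, map_C, map_ofNat (algebraMap F[X] (RatFunc F)) 2]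
    show MS2021.IsSPS 2 0 f
    refine ⟨fun _ j _ => Fin.elim0 j, ?_⟩
    rw [← hGf, hG2, map_C, map_ofNat, map_ofNat, Fin.sum_univ_two]
    simp only [Finset.univ_eq_empty, Finset.prod_empty]
    norm_num
  obtain ⟨d, rfl⟩ : ∃ d', d = d' + 1 := ⟨d - 1, by omega⟩
  -- a zero affine factor: `g` is a single product, `f ∈ ΠΣ ⊆ Σ^{[2]}ΠΣ`
  by_cases hzero : ∃ i j, α i j = 0
  · left
    obtain ⟨i, j, hij⟩ := hzero
    have hprod0 : (∏ j, (C (α i j none) + ∑ m, C (α i j (some m)) * X m) :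
        MvPolynomial (Fin n) (RatFunc F)) = 0 := by
      apply Finset.prod_eq_zero (Finset.mem_univ j)
      simp [hij]
    have hi : i = 0 ∨ i = 1 := by
      fin_cases i
      · exact Or.inl rfl
      · exact Or.inr rfl
    have hg1 : MS2021.IsSPS 1 (d + 1) g := by
      rcases hi with rfl | rfl
      · refine ⟨fun _ j o => α 1 j o, ?_⟩
        rw [hgα, Fin.sum_univ_one, Fin.sum_univ_two, hprod0, zero_add]
      · refine ⟨fun _ j o => α 0 j o, ?_⟩
        rw [hgα, Fin.sum_univ_one, Fin.sum_univ_two, hprod0, add_zero]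
    show MS2021.IsSPS 2 (d + 1) f
    exact isSPS_two_of_one (isSPS_one_of_isEpsApprox hg1 hfg)
  push Not at hzero
  -- normalise every factor
  choose c β hc hαβ hβ using fun i j => exists_normalize_family (α i j) (hzero i j)
  -- integral models of the two products and their reductions
  set T : Fin 2 → MvPolynomial (Fin n) F[X] :=
    fun i => ∏ j, (C (β i j none) + ∑ m, C (β i j (some m)) * X m) with hT
  have hTmap : ∀ i, map (Polynomial.constantCoeff : F[X] →+* F) (T i) =
      ∏ j, (C ((β i j none).coeff 0) + ∑ m, C ((β i j (some m)).coeff 0) * X m) := by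
    intro i
    simp only [hT, map_prod]
    refine Finset.prod_congr rfl fun j _ => ?_
    rw [map_affine]
    rfl
  have hTred : ∀ i, map (Polynomial.constantCoeff : F[X] →+* F) (T i) ≠ 0 := by
    intro i
    rw [hTmap i]
    refine Finset.prod_ne_zero_iff.mpr fun j _ => ?_
    exact affine_ne_zero (β := fun o => (β i j o).coeff 0) (hβ i j)
  -- `∏_j ℓ(α i j) = C (∏_j c i j) * map ι (T i)`
  have hgT : ∀ i, (∏ j, (C (α i j none) + ∑ m, C (α i j (some m)) * X m) :
      MvPolynomial (Fin n) (RatFunc F)) =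
        C (∏ j, c i j) * map (algebraMap F[X] (RatFunc F)) (T i) := by
    intro i
    simp only [hT, map_prod (map (algebraMap F[X] (RatFunc F))), map_prod C,
      ← Finset.prod_mul_distrib]
    refine Finset.prod_congr rfl fun j _ => ?_
    rw [map_affine, C_mul_affine (c i j) (fun o => algebraMap F[X] (RatFunc F) (β i j o))]
    congr 1
    · rw [hαβ i j none]
    · refine Finset.sum_congr rfl fun m _ => ?_
      rw [hαβ i j (some m)]
  have hcc : ∀ i, (∏ j, c i j) ≠ 0 := fun i => Finset.prod_ne_zero_iff.mpr fun j _ => hc i j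
  choose a b P Q hP hQ hPQ using fun i => exists_normalize_ne_zero (∏ j, c i j) (hcc i)
  -- the integral identity `ε^{a₀+b₁} P₀Q₁ T₀ + ε^{a₁+b₀} P₁Q₀ T₁ = ε^{b₀+b₁} Q₀Q₁ G`
  have key : C (Polynomial.X ^ (a 0 + b 1) * (P 0 * Q 1)) * T 0 +
      C (Polynomial.X ^ (a 1 + b 0) * (P 1 * Q 0)) * T 1 =
        C (Polynomial.X ^ (b 0 + b 1) * (Q 0 * Q 1)) * G := by
    apply map_injective (algebraMap F[X] (RatFunc F)) hinj
    have hsum : g = C (∏ j, c 0 j) * map (algebraMap F[X] (RatFunc F)) (T 0) +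
        C (∏ j, c 1 j) * map (algebraMap F[X] (RatFunc F)) (T 1) := by
      rw [hgα, Fin.sum_univ_two, hgT 0, hgT 1]
    have e0 := congrArg (fun x => (C x : MvPolynomial (Fin n) (RatFunc F))) (hPQ 0)
    have e1 := congrArg (fun x => (C x : MvPolynomial (Fin n) (RatFunc F))) (hPQ 1)
    simp only [map_mul, map_pow] at e0 e1
    rw [map_add, map_mul (map (algebraMap F[X] (RatFunc F))) (C _) (T 0),
      map_mul (map (algebraMap F[X] (RatFunc F))) (C _) (T 1),
      map_mul (map (algebraMap F[X] (RatFunc F))) (C _) G, map_C, map_C, map_C, hGg, hsum]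
    simp only [map_mul, map_pow, pow_add]
    linear_combination
      (-(C (algebraMap F[X] (RatFunc F) Polynomial.X) ^ b 1 *
          C (algebraMap F[X] (RatFunc F) (Q 1)) * map (algebraMap F[X] (RatFunc F)) (T 0))) * e0 +
        (-(C (algebraMap F[X] (RatFunc F) Polynomial.X) ^ b 0 *
          C (algebraMap F[X] (RatFunc F) (Q 0)) * map (algebraMap F[X] (RatFunc F)) (T 1))) * e1
  have hR₀ : (P 0 * Q 1).coeff 0 ≠ 0 := by
    rw [Polynomial.mul_coeff_zero]; exact mul_ne_zero (hP 0) (hQ 1)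
  have hR₁ : (P 1 * Q 0).coeff 0 ≠ 0 := by
    rw [Polynomial.mul_coeff_zero]; exact mul_ne_zero (hP 1) (hQ 0)
  have hR₂ : (Q 0 * Q 1).coeff 0 ≠ 0 := by
    rw [Polynomial.mul_coeff_zero]; exact mul_ne_zero (hQ 0) (hQ 1)
  rcases two_term_limit hR₀ hR₁ (hTred 0) (hTred 1) key with ⟨-, -, hred⟩ | ⟨h01, hlt, hbal⟩
  · -- exact case: `f = w₀ t₀ + w₁ t₁` over `F`
    left
    rw [hGf] at hred
    set w : Fin 2 → F := ![((Q 0 * Q 1).coeff 0)⁻¹ *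
        (if a 0 + b 1 = b 0 + b 1 then (P 0 * Q 1).coeff 0 else 0),
      ((Q 0 * Q 1).coeff 0)⁻¹ *
        (if a 1 + b 0 = b 0 + b 1 then (P 1 * Q 0).coeff 0 else 0)] with hw
    have hfw : f = ∑ i, C (w i) * map (Polynomial.constantCoeff : F[X] →+* F) (T i) := by
      have hC : (C ((Q 0 * Q 1).coeff 0) : MvPolynomial (Fin n) F) ≠ 0 := C_ne_zero.mpr hR₂
      apply mul_left_cancel₀ hC
      rw [← hred, Fin.sum_univ_two, mul_add, ← mul_assoc, ← mul_assoc, ← C_mul, ← C_mul, hw]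
      simp only [Matrix.cons_val_zero, Matrix.cons_val_one]
      rw [← mul_assoc, ← mul_assoc, mul_inv_cancel₀ hR₂, one_mul, one_mul]
    show MS2021.IsSPS 2 (d + 1) f
    refine ⟨fun i j o => if j = 0 then w i * (β i j o).coeff 0 else (β i j o).coeff 0, ?_⟩
    rw [hfw]
    refine Finset.sum_congr rfl fun i _ => ?_
    rw [hTmap i, Fin.prod_univ_succ, Fin.prod_univ_succ, ← mul_assoc]
    -- (`congr 1` closes the factors `j.succ`, whose `if j.succ = 0` reduces definitionally)
    congr 1
    rw [C_mul_affine (w i) (fun o => (β i 0 o).coeff 0)]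
    simp
  · -- balanced case
    right
    refine ⟨b 0 + b 1 - (a 0 + b 1), ![P 0 * Q 1, P 1 * Q 0], β, C (Q 0 * Q 1) * G,
      (Q 0).coeff 0 * (Q 1).coeff 0, by omega, ?_, mul_ne_zero (hQ 0) (hQ 1), hβ, ?_, ?_⟩
    · intro i
      fin_cases i
      · exact hR₀
      · exact hR₁
    · rw [map_mul, map_C, hGf, Polynomial.constantCoeff_apply, Polynomial.mul_coeff_zero]
    · rw [Fin.sum_univ_two]
      simp only [Matrix.cons_val_zero, Matrix.cons_val_one]
      rw [← mul_assoc, ← C_mul]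
      simp only [hT] at hbal
      exact hbal

end TopFaninTwo

end DDS2021

end Literature.Computability.AlgebraicComplexity

end
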